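import Literature.Computability.Complexity.OccurrenceObstructionsIPProofs
import Literature.Computability.AlgebraicComplexity.MultiplicityObstructionsProofs
import HarnessLib

/-!
# `ValuativeGCT.ValuativeFlip` (stmt-ValiantsHypothesis-12624): the padding lift of orbit-closure
# multiplicities, modulo derivative preimages — size-transfer axis, part III (the exact residual)

Crux `ValuativeFlip` of route `ValuativeGCT` (wall-breaker decomposition k12/16, axis "representation-
stability transfer between `m` and `m + 1`", 2026-08-16).  The per-side transfer the axis asks for is
PADDING MONOTONICITY for orbit closures: for a form `p` of degree `m` in the `m²` lexicographic matrix
variables, a form `q` of degree `N = m + j` in the `N²` variables, and a shape `λ ⊢ m·δ`,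
`mult_{λ*} ℂ[Δ_m(p)] ≤ mult_{(λ♯N)*} ℂ[Δ_N(q)]`, `λ♯N = λ + (jδ)`, whenever `Δ_N(q)` contains the padded
orbit `X_top^j · ι(GL_{m²} · p)` (`ι` = placement on the final segment).  With `p = X₀₀^{m-n} per_n`,
`q = X₀₀^{m-n} per_{n+j}` (the padded orbit is absorbed block-diagonally, `X^j ℓ^{m-n} per_n(A) =
ℓ^{m-n} per_{n+j}(X·1_j ⊕ A)`) this would be the diagonal transfer `(n, m, λ) → (n+j, m+j, λ♯)` of
per-side lower bounds.

The in-tree Kadish–Landsberg/BIP lifting `L = liftHWV m j` (`OccurrenceObstructionsIPProofs`: rename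
along the final segment, then the inner lift `F ↦ F ∘ ∂_top^j`) maps highest-weight vectors of weight
`λ*` to highest-weight vectors of weight `(λ♯N)*` and evaluates as `(L F)(q') = F((∂_top^j q')|segment)`
(`aeval_formCoeff_innerLift`, `aeval_formCoeff_rename_degIdxMap`).  On a padded point `X_top^j ι(f)`
this is `F(Δ f)` with `Δ` the diagonal scaling of BIP Lemma 5.2 — NOT `F(f)`: the twist `Δ` neither
preserves highest-weight spaces nor `GL`-orbits, so for ORBIT CLOSURES (as opposed to the variety of
all padded forms, where `Δ` is a harmless bijection) the lifting proves padding monotonicity exactly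
under the hypothesis formalised here:

* `orbitMultiplicity_le_rowLift_of_derivPreimage` — if every point `g · p` of the orbit of `p` is the
  segment restriction of the `j`-th `X_top`-derivative of SOME point of `Δ_N(q)` ("`Δ_N(q)` contains
  derivative preimages of the orbit", e.g. the `X_top`-antiderivatives `I_top^j(g · p)`), then
  `mult_{λ*} ℂ[Δ_m(p)] ≤ mult_{(λ♯N)*} ℂ[Δ_N(q)]`.  Proof: `F ↦ L F mod I(Δ_N q)` kills only
  highest-weight vectors vanishing on the orbit of `p` (evaluate at the preimages), and highest-weight
  vectors of `ℂ[Δ_m(p)]` lift to `ℂ[Sym^m]` (complete reducibility, `map_highestWeightSpace_eq_of_surjective`);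
  rank–nullity.
* `plethysmCoeff_le_orbitMultiplicity_rowLift_of_forall_mem` — the all-forms case (IP17 Prop. 2.6(b)
  with `det` replaced by any `q`): if `X_top^j ι(f) ∈ Δ_N(q)` for EVERY form `f` of degree `m`, then
  `a_λ(δ[m]) ≤ mult_{(λ♯N)*} ℂ[Δ_N(q)]` (here the preimage of `f` is `X_top^j ι(Δ⁻¹ f)`).

RESIDUAL of the axis (AXIS.md): for `p = X₀₀^{m-n} per_n`, `q = X₀₀^{m-n} per_{n+j}` the hypothesis of
the first theorem — membership of `X_top`-antiderivatives (Euler-resolvent averages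
`∫₀¹ (t_u · h) w(u) du` of orbit points) in `Δ_N(q)` — is open and heuristically false; padding
monotonicity for orbit closures itself (Kadish–Landsberg 2014 Question 1.5 for cousins of orbit
closures) has no proof in print.

Sources: C. Ikenmeyer, G. Panova, Adv. Math. 319 (2017) Prop. 2.6(b); P. Bürgisser, C. Ikenmeyer,
G. Panova, J. AMS 32 (2019) Lemma 5.2–5.3, Thm. 5.4, Remark after Thm. 4.6 ("unexpectedly subtle");
H. Kadish, J. M. Landsberg, Commun. Algebra 42 (2014) §1 (Question 1.5); Bläser–Ikenmeyer 2025 §12.4.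
-/

set_option linter.dupNamespace false

namespace Summit.ValiantsHypothesis.ValiantsHypothesis.Theorems.ValuativeFlip

open scoped BigOperators
open MvPolynomial
open Literature.NumberTheory.DiophantineGeometry
open Literature.Computability.AlgebraicComplexity
open Literature.Computability.Complexity

noncomputable section

/-- Every polynomial of the vanishing ideal of the orbit of a nonzero form `f` vanishes at every point
of the orbit CLOSURE `Δ(f)` (`mem_orbitClosure_iff_formCoeff_holds`; the `det` instance is
`aeval_formCoeff_eq_zero_of_mem_orbitClosure_detFormLex`). [Mulmuley–Sohoni 2001 §4; folklore] -/
theorem aeval_formCoeff_eq_zero_of_mem_orbitClosure_of_mem {σ : Type*} [Fintype σ] [LinearOrder σ]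
    {f q' : MvPolynomial σ ℂ} {n : ℕ} (hf : f.IsHomogeneous n) (hf0 : f ≠ 0)
    (hq' : q' ∈ orbitClosure f) {F : MvPolynomial (DegIdx σ n) ℂ} (hF : F ∈ orbitVanishingIdeal f n) :
    aeval (formCoeff n q') F = 0 := by
  have h := ((mem_orbitClosure_iff_formCoeff_holds hf hf0).mp hq').2
  rw [MvPolynomial.mem_zeroLocus_iff] at h
  exact h F hF

/-- **Evaluation of the Kadish–Landsberg lift at an arbitrary form**: `(L F)(q') = F((∂_top^j q')|segment)`
for `q'` homogeneous of degree `m + j` (`aeval_formCoeff_innerLift` then `aeval_formCoeff_rename_degIdxMap`).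
[Bürgisser–Ikenmeyer–Panova 2019 Thm. 5.4; Ikenmeyer–Panova 2017 Prop. 2.6(b)] -/
theorem aeval_formCoeff_liftHWV {m : ℕ} (j : ℕ) [NeZero (m + j)] {q' : MvPolynomial (MatIdx (m + j)) ℂ}
    (hq' : q'.IsHomogeneous (m + j)) (F : MvPolynomial (DegIdx (MatIdx m) m) ℂ) :
    aeval (formCoeff (m + j) q') (liftHWV m j F) =
      aeval (formCoeff m (killCompl (segEmb_strictMono (Nat.le_add_right m j)).injective
        (iterPderiv (topMatIdx (m + j)) j q'))) F := by
  rw [liftHWV, AlgHom.comp_apply, aeval_formCoeff_innerLift _ hq', Nat.add_sub_cancel_left,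
    aeval_formCoeff_rename_degIdxMap]

/-- **Padding monotonicity of orbit-closure multiplicities, modulo derivative preimages.**  Let `p`
be a form of degree `m` in the variables `MatIdx m`, `q ≠ 0` a form of degree `m + j` in the variables
`MatIdx (m + j)`, `λ ⊢ m·δ` with at most `m²` parts.  If for every `g ∈ GL_{m²}` there is a point `q'`
of the orbit closure `Δ(q)` whose `j`-th derivative in the top variable, restricted to the final
segment `ι(MatIdx m)`, is `g · p`, then
`mult_{λ*} ℂ[Δ_m(p)] ≤ mult_{(λ♯(m+j))*} ℂ[Δ_{m+j}(q)]` (the Kadish–Landsberg lift `liftHWV` reduced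
modulo `I(Δ q)` has kernel inside the highest-weight vectors vanishing on `GL · p`; rank–nullity
against the surjection `HWV_{λ*}(ℂ[Sym^m]) ↠ HWV_{λ*}(ℂ[Δ_m(p)])`).
[Ikenmeyer–Panova 2017 Prop. 2.6(b); Bürgisser–Ikenmeyer–Panova 2019 Lemma 5.3, Thm. 5.4;
Bläser–Ikenmeyer 2025 §12.4] -/
theorem orbitMultiplicity_le_rowLift_of_derivPreimage {m : ℕ} [NeZero m] (j : ℕ) [NeZero (m + j)]
    {p : MvPolynomial (MatIdx m) ℂ} {q : MvPolynomial (MatIdx (m + j)) ℂ}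
    (hq : q.IsHomogeneous (m + j)) (hq0 : q ≠ 0)
    {δ : ℕ} (lam : Nat.Partition (m * δ)) (hlam : lam.parts.card ≤ m * m)
    (h : ∀ g : GL (MatIdx m) ℂ, ∃ q' ∈ orbitClosure q,
      killCompl (segEmb_strictMono (Nat.le_add_right m j)).injective
          (iterPderiv (topMatIdx (m + j)) j q') = linSubstRep (MatIdx m) ℂ g p) :
    orbitMultiplicity ℂ p m (partitionWeightLex m lam) ≤
      orbitMultiplicity ℂ q (m + j) (partitionWeightLex (m + j) (rowLift lam j)) := by
  classical
  haveI hfinH : FiniteDimensional ℂ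
      (highestWeightSpace (coordRep (MatIdx m) ℂ m) (partitionWeightLex m lam)) :=
    finiteDimensional_highestWeightSpace_coordRep_holds (k := ℂ) (σ := MatIdx m) (NeZero.ne m) _
  haveI hfinQ : FiniteDimensional ℂ
      (highestWeightSpace (orbitCoordRep q (m + j)) (partitionWeightLex (m + j) (rowLift lam j))) :=
    finiteDimensional_highestWeightSpace_orbitCoordRep_holds (k := ℂ) q (NeZero.ne (m + j)) _
  -- the reduction maps are equivariant
  let mkp : (coordRep (MatIdx m) ℂ m).IntertwiningMap (orbitCoordRep p m) :=
    ⟨(Ideal.Quotient.mkₐ ℂ (orbitVanishingIdeal p m)).toLinearMap, fun _ => LinearMap.ext fun _ => rfl⟩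
  let mkq : (coordRep (MatIdx (m + j)) ℂ (m + j)).IntertwiningMap (orbitCoordRep q (m + j)) :=
    ⟨(Ideal.Quotient.mkₐ ℂ (orbitVanishingIdeal q (m + j))).toLinearMap, fun _ => LinearMap.ext fun _ => rfl⟩
  -- `Φ : F ↦ L F mod I(Δ q)` lands in the highest-weight space of `ℂ[Δ q]`
  have hmem : ∀ F : highestWeightSpace (coordRep (MatIdx m) ℂ m) (partitionWeightLex m lam),
      Ideal.Quotient.mkₐ ℂ (orbitVanishingIdeal q (m + j)) (liftHWV m j (F : MvPolynomial _ ℂ)) ∈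
        highestWeightSpace (orbitCoordRep q (m + j)) (partitionWeightLex (m + j) (rowLift lam j)) :=
    fun F => highestWeightSpace_le_comap_intertwiningMap mkq _
      (liftHWV_mem_highestWeightSpace lam hlam j F.2)
  let Φ : highestWeightSpace (coordRep (MatIdx m) ℂ m) (partitionWeightLex m lam) →ₗ[ℂ]
      highestWeightSpace (orbitCoordRep q (m + j)) (partitionWeightLex (m + j) (rowLift lam j)) :=
    LinearMap.codRestrict _ ((Ideal.Quotient.mkₐ ℂ (orbitVanishingIdeal q (m + j))).toLinearMap.comp
      ((liftHWV m j).toLinearMap.comp (Submodule.subtype _))) hmem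
  -- `πp : F ↦ F mod I(Δ p)`
  let πp : highestWeightSpace (coordRep (MatIdx m) ℂ m) (partitionWeightLex m lam) →ₗ[ℂ]
      OrbitCoordRing p m :=
    (Ideal.Quotient.mkₐ ℂ (orbitVanishingIdeal p m)).toLinearMap.comp (Submodule.subtype _)
  -- the kernel of `Φ` consists of highest-weight vectors vanishing on `GL · p`
  have hker : LinearMap.ker Φ ≤ LinearMap.ker πp := by
    intro F hF
    rw [LinearMap.mem_ker] at hF ⊢
    have h0 : Ideal.Quotient.mkₐ ℂ (orbitVanishingIdeal q (m + j)) (liftHWV m j (F : MvPolynomial _ ℂ)) = 0 :=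
      congrArg Subtype.val hF
    have hIq : liftHWV m j (F : MvPolynomial _ ℂ) ∈ orbitVanishingIdeal q (m + j) := by
      rwa [Ideal.Quotient.mkₐ_eq_mk, Ideal.Quotient.eq_zero_iff_mem] at h0
    have hIp : (F : MvPolynomial _ ℂ) ∈ orbitVanishingIdeal p m := by
      rw [mem_orbitVanishingIdeal_iff]
      intro g
      obtain ⟨q', hq', hEq⟩ := h g
      have hvan := aeval_formCoeff_eq_zero_of_mem_orbitClosure_of_mem hq hq0 hq' hIq
      rw [aeval_formCoeff_liftHWV j (hq.of_mem_orbitClosure hq') (F : MvPolynomial _ ℂ), hEq] at hvan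
      exact hvan
    change Ideal.Quotient.mkₐ ℂ (orbitVanishingIdeal p m) (F : MvPolynomial _ ℂ) = 0
    rw [Ideal.Quotient.mkₐ_eq_mk, Ideal.Quotient.eq_zero_iff_mem]
    exact hIp
  -- highest-weight vectors of `ℂ[Δ p]` are the reductions of those of `ℂ[Sym^m]`
  have hrange : LinearMap.range πp = highestWeightSpace (orbitCoordRep p m) (partitionWeightLex m lam) := by
    rw [LinearMap.range_comp, Submodule.range_subtype]
    exact map_highestWeightSpace_eq_of_surjective mkp (Ideal.Quotient.mkₐ_surjective ℂ _)
      (isSemisimpleRepresentation_coordRep m) _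
  -- rank–nullity
  have h1 := LinearMap.finrank_range_add_finrank_ker πp
  have h2 := LinearMap.finrank_range_add_finrank_ker Φ
  have h3 : Module.finrank ℂ (LinearMap.ker Φ) ≤ Module.finrank ℂ (LinearMap.ker πp) :=
    Submodule.finrank_mono hker
  have h4 : Module.finrank ℂ (LinearMap.range Φ) ≤ Module.finrank ℂ
      (highestWeightSpace (orbitCoordRep q (m + j)) (partitionWeightLex (m + j) (rowLift lam j))) :=
    Submodule.finrank_le _
  change Module.finrank ℂ (highestWeightSpace (orbitCoordRep p m) (partitionWeightLex m lam)) ≤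
    Module.finrank ℂ (highestWeightSpace (orbitCoordRep q (m + j)) (partitionWeightLex (m + j) (rowLift lam j)))
  rw [← hrange]
  omega

/-- **The all-forms case (IP17 Prop. 2.6(b), arbitrary target).**  If the padded form
`X_top^j · ι(f)` of EVERY form `f` of degree `m` lies in `Δ_{m+j}(q)` (`q ≠ 0` a form of degree
`m + j`), then `a_λ(δ[m]) ≤ mult_{(λ♯(m+j))*} ℂ[Δ_{m+j}(q)]` for every `λ ⊢ m·δ` with at most `m²` parts:
the lift reduced modulo `I(Δ q)` is injective on highest-weight vectors, because `L F` vanishing on all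
padded forms means `F ∘ Δ = 0` with `Δ` the invertible diagonal scaling of BIP Lemma 5.2
(`aeval_formCoeff_paddedForm_liftHWV`).  For `q = det_{m+j}` this is the in-tree
`plethysmCoeff_le_orbitMultiplicity_rowLift`. [Ikenmeyer–Panova 2017 Prop. 2.6(b);
Bürgisser–Ikenmeyer–Panova 2019 Lemma 5.2, Thm. 5.4] -/
theorem plethysmCoeff_le_orbitMultiplicity_rowLift_of_forall_mem {m : ℕ} [NeZero m] (j : ℕ) [NeZero (m + j)]
    {q : MvPolynomial (MatIdx (m + j)) ℂ} (hq : q.IsHomogeneous (m + j)) (hq0 : q ≠ 0)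
    {δ : ℕ} (lam : Nat.Partition (m * δ)) (hlam : lam.parts.card ≤ m * m)
    (h : ∀ f : MvPolynomial (MatIdx m) ℂ, f.IsHomogeneous m → paddedForm m j f ∈ orbitClosure q) :
    plethysmCoeff ℂ (MatIdx m) m (partitionWeightLex m lam) ≤
      orbitMultiplicity ℂ q (m + j) (partitionWeightLex (m + j) (rowLift lam j)) := by
  classical
  haveI hfinQ : FiniteDimensional ℂ
      (highestWeightSpace (orbitCoordRep q (m + j)) (partitionWeightLex (m + j) (rowLift lam j))) :=
    finiteDimensional_highestWeightSpace_orbitCoordRep_holds (k := ℂ) q (NeZero.ne (m + j)) _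
  haveI hfinH : FiniteDimensional ℂ
      (highestWeightSpace (coordRep (MatIdx m) ℂ m) (partitionWeightLex m lam)) :=
    finiteDimensional_highestWeightSpace_coordRep_holds (k := ℂ) (σ := MatIdx m) (NeZero.ne m) _
  let mk : (coordRep (MatIdx (m + j)) ℂ (m + j)).IntertwiningMap (orbitCoordRep q (m + j)) :=
    ⟨(Ideal.Quotient.mkₐ ℂ (orbitVanishingIdeal q (m + j))).toLinearMap, fun _ => LinearMap.ext fun _ => rfl⟩
  have hmem : ∀ F : highestWeightSpace (coordRep (MatIdx m) ℂ m) (partitionWeightLex m lam),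
      Ideal.Quotient.mkₐ ℂ (orbitVanishingIdeal q (m + j)) (liftHWV m j (F : MvPolynomial _ ℂ)) ∈
        highestWeightSpace (orbitCoordRep q (m + j)) (partitionWeightLex (m + j) (rowLift lam j)) :=
    fun F => highestWeightSpace_le_comap_intertwiningMap mk _
      (liftHWV_mem_highestWeightSpace lam hlam j F.2)
  let Φ : highestWeightSpace (coordRep (MatIdx m) ℂ m) (partitionWeightLex m lam) →ₗ[ℂ]
      highestWeightSpace (orbitCoordRep q (m + j)) (partitionWeightLex (m + j) (rowLift lam j)) :=
    LinearMap.codRestrict _ ((Ideal.Quotient.mkₐ ℂ (orbitVanishingIdeal q (m + j))).toLinearMap.comp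
      ((liftHWV m j).toLinearMap.comp (Submodule.subtype _))) hmem
  have hΦ : Function.Injective Φ := by
    rw [← LinearMap.ker_eq_bot, LinearMap.ker_eq_bot']
    intro F hF0
    have h0 : Ideal.Quotient.mkₐ ℂ (orbitVanishingIdeal q (m + j)) (liftHWV m j (F : MvPolynomial _ ℂ)) = 0 :=
      congrArg Subtype.val hF0
    have hI : liftHWV m j (F : MvPolynomial _ ℂ) ∈ orbitVanishingIdeal q (m + j) := by
      rwa [Ideal.Quotient.mkₐ_eq_mk, Ideal.Quotient.eq_zero_iff_mem] at h0
    -- `F(Δ f) = 0` for every form `f`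
    have hvan : ∀ f : MvPolynomial (MatIdx m) ℂ, f.IsHomogeneous m →
        aeval (fun e : DegIdx (MatIdx m) m =>
          (((e.1 (topMatIdx m) + j).descFactorial j : ℕ) : ℂ) * coeff e.1 f) (F : MvPolynomial _ ℂ) = 0 := by
      intro f hf
      rw [← aeval_formCoeff_paddedForm_liftHWV j hf]
      exact aeval_formCoeff_eq_zero_of_mem_orbitClosure_of_mem hq hq0 (h f hf) hI
    -- `Δ` is onto
    apply Subtype.ext
    refine MvPolynomial.funext fun x => ?_
    rw [ZeroMemClass.coe_zero, map_zero]
    obtain ⟨f, hf, hcoeff⟩ := exists_formCoeff_eq (k := ℂ)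
      (fun e : DegIdx (MatIdx m) m => x e / (((e.1 (topMatIdx m) + j).descFactorial j : ℕ) : ℂ))
    have hx : (fun e : DegIdx (MatIdx m) m =>
        (((e.1 (topMatIdx m) + j).descFactorial j : ℕ) : ℂ) * coeff e.1 f) = x := by
      funext e
      have hc : ((((e.1 (topMatIdx m) + j).descFactorial j : ℕ) : ℂ)) ≠ 0 :=
        Nat.cast_ne_zero.2 (descFactorial_add_pos _ _).ne'
      have := congrFun hcoeff e
      rw [formCoeff_apply] at this
      rw [this, mul_div_cancel₀ _ hc]
    have h' := hvan f hf
    rw [hx] at h'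
    exact h'
  exact LinearMap.finrank_le_finrank_of_injective hΦ

end

end Summit.ValiantsHypothesis.ValiantsHypothesis.Theorems.ValuativeFlip
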